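import Mathlib.MeasureTheory.Integral.IntervalIntegral.AbsolutelyContinuousFun
import Mathlib.Analysis.Calculus.ContDiff.Deriv
import HarnessLib

/-!
# The chain rule along an integrable primitive ("renormalisation in time")

Analysis/Calculus support file (everything proved). For `g ∈ L¹(a, b)`, a constant `c` and a
globally Lipschitz `C¹` function `β : ℝ → ℝ`:

  `β(c + ∫ₐᵇ g) = β(c) + ∫ₐᵇ β'(c + ∫ₐˢ g) g(s) ds`

(`Literature.Analysis.Calculus.comp_primitive_eq_add_integral`): the primitive is absolutely
continuous, so is its composition with the Lipschitz `β`, the derivative of the composition is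
`β'(P) g` a.e. (Lebesgue differentiation), and the fundamental theorem of calculus holds for
absolutely continuous functions (`AbsolutelyContinuousOnInterval.integral_deriv_eq_sub`).
This is the time-chain-rule behind the renormalised (DiPerna–Lions) energy balance of merely
measurable-in-time weak solutions, where `P(t, x) = (θ₀ ⋆ k)(x) + ∫₀ᵗ G(s, x) ds` is the
mollified solution at a fixed point `x` (DiPerna–Lions 1989, §II; Seis 2022 uses the resulting
energy inequality for `L² ∩ Ḣ¹` drifts).

## References

* R. J. DiPerna, P.-L. Lions, Invent. Math. 98 (1989), §II.1–II.3 (renormalisation).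
  [`DiPernaLions1989`]
-/

noncomputable section

open MeasureTheory Set Filter Topology intervalIntegral
open scoped Interval

namespace Literature.Analysis.Calculus

/-- **Composition of an absolutely continuous function with a Lipschitz function is absolutely
continuous.** [folklore] -/
theorem absolutelyContinuousOnInterval_comp_of_lipschitzWith {X Y : Type*} [PseudoMetricSpace X]
    [PseudoMetricSpace Y] {P : ℝ → X} {a b : ℝ} (hP : AbsolutelyContinuousOnInterval P a b)
    {β : X → Y} {K : NNReal} (hβ : LipschitzWith K β) :
    AbsolutelyContinuousOnInterval (β ∘ P) a b := by
  rw [absolutelyContinuousOnInterval_iff] at hP ⊢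
  intro ε hε
  obtain ⟨δ, hδ, hPδ⟩ := hP (ε / (K + 1)) (by positivity)
  refine ⟨δ, hδ, fun E hE hlen => ?_⟩
  have hK : (0 : ℝ) ≤ K := K.2
  calc ∑ i ∈ Finset.range E.1, dist ((β ∘ P) (E.2 i).1) ((β ∘ P) (E.2 i).2)
      ≤ ∑ i ∈ Finset.range E.1, K * dist (P (E.2 i).1) (P (E.2 i).2) :=
        Finset.sum_le_sum fun i _ => hβ.dist_le_mul _ _
    _ = K * ∑ i ∈ Finset.range E.1, dist (P (E.2 i).1) (P (E.2 i).2) := (Finset.mul_sum _ _ _).symm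
    _ ≤ K * (ε / (K + 1)) := mul_le_mul_of_nonneg_left (hPδ E hE hlen).le hK
    _ < (K + 1) * (ε / (K + 1)) := by gcongr; linarith
    _ = ε := by field_simp

/-- **The chain rule along an integrable primitive.** For `g` interval-integrable on `[a, b]`
(`a ≤ b`), a constant `c`, and a globally Lipschitz `C¹` function `β : ℝ → ℝ`:
`β (c + ∫ₐᵇ g) = β c + ∫ₐᵇ β'(c + ∫ₐˢ g) g(s) ds`
(DiPerna–Lions 1989, §II, the renormalised equation integrated in time, at a fixed point).
[cite: DiPernaLions1989, §II.3] -/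
theorem comp_primitive_eq_add_integral {g : ℝ → ℝ} {a b c : ℝ} (hab : a ≤ b)
    (hg : IntervalIntegrable g volume a b) {β : ℝ → ℝ} (hβ : ContDiff ℝ 1 β) {K : NNReal}
    (hβK : LipschitzWith K β) :
    β (c + ∫ s in a..b, g s) = β c + ∫ s in a..b, deriv β (c + ∫ r in a..s, g r) * g s := by
  set P : ℝ → ℝ := fun s => c + ∫ r in a..s, g r with hP
  have haI : a ∈ uIcc a b := by rw [uIcc_of_le hab]; exact left_mem_Icc.2 hab
  -- `P` is absolutely continuous, hence so is `β ∘ P`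
  have hPac : AbsolutelyContinuousOnInterval P a b := by
    have h1 : AbsolutelyContinuousOnInterval (fun _ : ℝ => c) a b :=
      ((LipschitzWith.const c).lipschitzOnWith (s := uIcc a b)).absolutelyContinuousOnInterval
    exact h1.add (hg.absolutelyContinuousOnInterval_intervalIntegral haI)
  have hβP : AbsolutelyContinuousOnInterval (β ∘ P) a b :=
    absolutelyContinuousOnInterval_comp_of_lipschitzWith hPac hβK
  -- FTC for `β ∘ P`
  have hftc := hβP.integral_deriv_eq_sub
  have hPa : P a = c := by simp [hP]
  have hPb : P b = c + ∫ s in a..b, g s := rfl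
  -- the derivative of `β ∘ P` is `β'(P) g` a.e.
  have hderiv : ∀ᵐ s, s ∈ Ι a b → deriv (β ∘ P) s = deriv β (P s) * g s := by
    filter_upwards [hg.ae_hasDerivAt_integral] with s hs hsI
    have hsI' : s ∈ uIcc a b := uIoc_subset_uIcc hsI
    have hP' : HasDerivAt P (g s) s := (hs hsI' a haI).const_add c
    have hβ' : HasDerivAt β (deriv β (P s)) (P s) := (hβ.differentiable one_ne_zero (P s)).hasDerivAt
    exact (hβ'.comp s hP').deriv
  rw [integral_congr_ae hderiv, Function.comp_apply, Function.comp_apply, hPa, hPb] at hftc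
  linarith

/-- Set-integral form on `(0, t]`: for `g` integrable on `(0, t]` (`0 ≤ t`),
`β (c + ∫_{(0,t]} g) = β c + ∫_{(0,t]} β'(c + ∫_{(0,s]} g) g(s) ds`. [folklore] -/
theorem comp_const_add_setIntegral_eq {g : ℝ → ℝ} {t c : ℝ} (ht : 0 ≤ t)
    (hg : IntegrableOn g (Ioc 0 t) volume) {β : ℝ → ℝ} (hβ : ContDiff ℝ 1 β) {K : NNReal}
    (hβK : LipschitzWith K β) :
    β (c + ∫ s in Ioc 0 t, g s) =
      β c + ∫ s in Ioc 0 t, deriv β (c + ∫ r in Ioc 0 s, g r) * g s := by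
  have hgI : IntervalIntegrable g volume 0 t := (intervalIntegrable_iff_integrableOn_Ioc_of_le ht).2 hg
  have h := comp_primitive_eq_add_integral ht hgI hβ hβK (c := c)
  rw [integral_of_le ht, integral_of_le ht] at h
  rw [h]
  congr 1
  refine setIntegral_congr_fun measurableSet_Ioc fun s hs => ?_
  rw [integral_of_le hs.1.le]

end Literature.Analysis.Calculus
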